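import Summits.QuantumFields.YangMills.Theorems.BalabanUVNodesN09HeredNestingOnMembershipFamily
import Summits.QuantumFields.YangMills.Theorems.BalabanUVNodesN09AtRecord13SepCoPHOnDomains

/-!
# NODE N09 — DOOR v1.3 (F-I-χ «ρ-edition», director-ym №313 (R2) design of record for FLAG №7′'s cure road): THE STAGE-13 `SepCoPH` ON-SETS ENGINE WITH THE (1.1)-DOMAIN `dom`
# AND THE FIBRE SETS `S` BOTH = A MEMBERSHIP FAMILY `domU^ρ`, bookkeeping sets `D (i+1) := regSet_i ∩ domU^ρ_{i+1}` — (1.1), the (8)-row, `hsolv`∕`huniqDom` DEFINITIONAL; [B11] content left =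
# `hres`∕`huniq` over `domU^ρ` (inside [B11]'s printed window iff `2B₃ρ ≤ a₀L²`); (1.1)–(1.3) ON THE MEMBERSHIP DOMAIN at the record's own Stage-13 objects (world-free), and the world-generic member

TRACK A (YM-PLAN §2d, node N09 of 28), seat `pub-ymgap-dag-n09-w1` (D-0149 width seat 1∕4), generation g8 — №307 (2)(P1) ∕ №313 (R2)(R3); DESIGN MEMO `HOME/pub-ymgap-dag-n09-w1/DESIGN-MEMO-door-v1.3.md`
§5.  Key of record K1⁹ stmt-QuantumFields-27364 (`--supports … --as helper`, count-neutral).  [I] = [Balaban1987RG1] (CMP 109), [B11] = [Balaban1985Variational] (CMP 102) (= «[15]» of [I]),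
[B7] = [Balaban1985Averaging] (CMP 98).  Imports KERNEL 2 `…N09HeredNestingOnMembershipFamily` (⇒ KERNEL 1, g2 FILES 1–2∕4–5, n09-w2 g2 `…N09AxialCovariance181`) and dag-n09-w3's FILE 5
`…N09AtRecord13SepCoPHOnDomains` (the on-sets engine `thm3Member_of_indATPlug_of_stepsOn_on` ∕ `hCompT_of_stepsOn_on` ∕ `stepOn_TβOfRecord₁₃_of_subset_regSet_inter_of_on`).  Typed over a
GENERIC family `dom` CHARACTERISED by the four membership conjuncts (`hdom`) so that it lands independently of Node00's `domUOfRecord` (whose `mem_domUOfRecord_iff` instantiates `hdom`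
by `Iff.rfl`).  THEOREMS ONLY (0 `def`, 0 `sorry`).

WHY (located, memo §4 ∕ `…N09Reg8RowAtEqualRadiiLocated` §3).  Door v1.2 keys N09's [B11] rows on the second-form plaquette set `domAltOfRecord θ.ν` for BOTH roles the Stage-13 engine has —
the (1.1)-domain `dom` (rows `h11 ∕ hreg8 ∕ hres ∕ huniq` at `θ.εbg`) and the fibre sets `S` over which χ₂₉ is lift-invariant (rows `hsolv ∕ huniqDom` at `θ.ν.εreg`, via FILE 7∕6) — and those
rows are jointly outside [B11] Thm 1's printed window (inner∕outer invariant `2B₃ ≤ L²`; one-radius window `[2B₃r∕L², a₀] = ∅` at the Z3 pin).  Print keys (1.1) on MEMBERSHIP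
(«U_k(V) ∈ 𝔘_k(ε₀)», [I] p. 260; «χ_k restricts the domain of integration to U_k(V) ∈ 𝔘_k(ε₀)», p. 265) with the membership radius small against [B11]'s `a₀`.  THIS FILE re-keys the engine:
* §0 a membership family is GAUGE-STABLE (`memChar_gaugeAct_mem` ∕ `_iff`: `domAlt` iff (dag-n09-w3), `ukExists_gaugeAct_iff` (n09-w2 g0), `uniqueUkOrbit_gaugeAct_iff` + `Uk_gaugeAct_orbitRel_blockLift`
  (n09-w2 g2) for the fourth conjunct) and SOLVABLE-UNIQUE AT THE CUT-OFF's RADIUS `ν.εreg` for `ρ ≤ ν.εreg ≤ εbg` (`hsolv_of_memChar` ∕ `huniqDom_of_memChar`: g2 FILE 1's pointwise transfer).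
* §1 (M1-dom) ON `S := dom`: `chiβ13_liftInvariant_ae_on_memChar` — χ₂₉_j is lift-invariant at (a.e.) every `U` with `Ū ∈ dom (j+1)`, from §0 + the on-`dom` axiality `haxDom` (n09-w2 g2's core
  `chiβ_liftInvariantOn_of_uniqueOrbit_of_axialOn`).  NO `hsolv`, NO `huniqDom`, NO covariance hypothesis.
* §2 ★★★ `hCompT_onMembershipFamily` — `HCompT` of the record's Stage-13 transport∕cut-offs ON `dom k` for every `k ≤ P.K` (dag-n09-w3's `hCompT_of_stepsOn_on` with `S := dom`,
  `D (i+1) := regSet_i ∩ dom (i+1)`), displayed: `cd`; `hopen : ∀ j < P.K, IsOpen (dom (j+1))` ([B11] Sect. G species — openness of the unique-solvable-membership set; (E)∧(I) are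
  `…N09InteriorSolvableSetOpen`, (U) is NOT in tree: INHABITED BY: not yet — debt «(U)-propagation»); `haxDom`, `haxbg` (conventions); `hχregU` (the MEMBERSHIP form of the pointwise (F7a)
  support clause, [I] p. 265 + [B11] Sect. G: INHABITED BY: not yet — K0e's analytic debt in membership form); (I19) `hint`; [B11]'s `hres`∕`huniq` over `dom` at `εbg` (N07; INHABITED BY: not yet
  — N07's Theorem-1 slot, inside [B11]'s window iff `2B₃ρ ≤ a₀L²`, `2ρ ≤ a₁L²`, `εbg ≤ a₀`, window INHABITED at the Z3 pin by `…Reg8RowAtEqualRadiiLocated.door_local_radius_fits_Z3_pin`);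
  letters `0 < ρ ≤ θ₀.ν.εreg ≤ εbg`, `0 < θ₀.ε₂₉`; [B7]-numerics ON `ρ`; `2ρ ≤ θ₀.ν.ε₀·L²`.  ★★★ `indA_onMembershipFamily` — (1.1)–(1.3) `IndAOfRecordT` ON `dom k` at the record's OWN
  Stage-13 objects whenever the flow recursion holds up to `k` (node00-def-B's `indAOfRecordT_atRecord`) — WORLD-FREE: a statement about the record, not about a hypothetical core.
* §3 ★★ `thm3Member_onMembershipFamily_of_hind` — the world-generic member (`hflow`, `hind` over `dom` DISPLAYED; INHABITED BY: not yet — no landed core has `dom := domU^ρ`, (D1′) deferred by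
  №313 (R4); the day it lands `hind` is `Iff.rfl`).
HONEST FRAMING: count-neutral kernel composition BY NAME; NOTHING of Bałaban's asserted ([B11]'s `hres`∕`huniq`, (F7a) in membership form, openness, the axiality conventions are DISPLAYED
hypotheses, each with its «INHABITED BY» clause per №300); NO carrier re-pointed; NO record core edited; under №313 (R4) «(D0)-labelled» this is the (G-a) WITNESS ROAD, not a discharge; N09 ∕ N07
∕ N24 NOT discharged; K0⁷ ∕ K1⁹ ∕ K3⁸ NOT closed; counts unmoved (typed 28∕28 · discharged 8∕28); one finite four-torus programme at fixed ε — R4 closes the conditional rung `BalabanLadder.UV`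
only; the Yang–Mills mass gap (Clay) is NOT proved by any of this; nothing continuum ∕ ℝ⁴ ∕ OS.  THEOREMS ONLY, standard axioms.
-/

noncomputable section

namespace Summit.QuantumFields.YangMills.BalabanUVNodes.N09MembershipDomainDoor

open MeasureTheory
open Literature.MathematicalPhysics.QuantumFieldTheory.Balaban1983to89
open Literature.MathematicalPhysics.QuantumFieldTheory.Balaban1983to89.T4Continuum (T4Family)
open Literature.MathematicalPhysics.QuantumFieldTheory.Balaban1983to89.DagBinding (WorldP leavesP)
open Literature.MathematicalPhysics.QuantumFieldTheory.Balaban1983to89.Node00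
open Literature.MathematicalPhysics.QuantumFieldTheory.Balaban1983to89.FlowStep (HBeta prefixOf RGEqH)
open Literature.MathematicalPhysics.QuantumFieldTheory.Balaban1983to89.FlowStepRuns (genSeq genFlow)
open Literature.MathematicalPhysics.QuantumFieldTheory.Balaban1983to89.ExpMeanLog (deltaSU)
open Literature.MathematicalPhysics.QuantumFieldTheory.Balaban1983to89.B12GaugeOrbits021 (OrbitRel)
open Literature.MathematicalPhysics.QuantumFieldTheory.Balaban1983to89.B12RTGaugeInvariance254 (liftTransf invTransf gaugeAct_inv_gaugeAct)
open Literature.MathematicalPhysics.QuantumFieldTheory.Balaban1983to89.B15Eq177GaugeInvariance (blockLift)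
open Literature.MathematicalPhysics.QuantumFieldTheory.Balaban1983to89.GaugeField (gaugeAct)
open Summit.QuantumFields.YangMills.BalabanUVNodes.N09BackgroundRadiiTransfer (bgReg_mono mem_bgReg_iff_of_orbitRel ukExists_of_le_of_Uk_mem uniqueUkOrbit_of_le_of_Uk_mem)
open Summit.QuantumFields.YangMills.BalabanUVNodes.N09LiftInvariance29AtRecord (ukExists_gaugeAct_iff gaugeAct_mem_bgReg succ_le_range_of_lt)
open Summit.QuantumFields.YangMills.BalabanUVNodes.N09AxialCovariance181 (uniqueUkOrbit_gaugeAct_iff Uk_gaugeAct_orbitRel_blockLift chiβ_liftInvariantOn_of_uniqueOrbit_of_axialOn)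
open Summit.QuantumFields.YangMills.BalabanUVNodes.N09AtRecord13SepCoPHOnDomains
  (thm3Member_of_indATPlug_of_stepsOn_on hCompT_of_stepsOn_on stepOn_TβOfRecord₁₃_of_subset_regSet_inter_of_on domAltOfRecord_gaugeAct_mem_iff)
open Summit.QuantumFields.YangMills.BalabanUVNodes.N09HeredNestingOnMembershipFamily (hnestD_of_suppU_of_hierAxial_of_memChar)

variable {F : T4Family} {N : ℕ} [NeZero N]

/-! ## §0. A membership family is gauge-stable and solvable-unique at the cut-off's radius -/

section MemChar

variable {ν : Stage7Numerics} {K : ℕ} {εbg ρ : ℝ} {dom : (k : ℕ) → Set (GaugeField (F.P K) k (SU N))}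
  (hdom : ∀ k (V : GaugeField (F.P K) k (SU N)), V ∈ dom k ↔
    V ∈ domAltOfRecord F N ν K k ∧ UkExists F N K k εbg V ∧ UniqueUkOrbit F N K k εbg V ∧ Uk F N K k εbg V ∈ bgReg F N K k ρ)

include hdom in
/-- **A MEMBERSHIP FAMILY IS GAUGE-STABLE** (successor levels, standing range `k + 1 ≤ m + K`): `W ∈ dom (k+1) ⇒ W^v ∈ dom (k+1)` — conjunct by conjunct: the second-form set (dag-n09-w3
`domAltOfRecord_gaugeAct_mem_iff`), solvability (n09-w2 g0 `ukExists_gaugeAct_iff`), orbit-uniqueness (n09-w2 g2 `uniqueUkOrbit_gaugeAct_iff`), and the membership conjunct: the chosen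
minimiser over `W^v` is a residual transform of `(U_{k+1} W)^{v∘B^{k+1}}` (n09-w2 g2 `Uk_gaugeAct_orbitRel_blockLift`), and plaquette classes are gauge- and orbit-invariant.
[cite: Balaban1987RG1, (0.21) p.256, (1.1)–(1.2) p.260 and p.259; Balaban1985Variational, Thm 1 p.279 and (181) p.307] -/
theorem memChar_gaugeAct_mem {k : ℕ} (hk : k + 1 ≤ (F.P K).m + (F.P K).K) (v : GaugeTransf (F.P K) (k + 1) (SU N))
    (W : GaugeField (F.P K) (k + 1) (SU N)) (hW : W ∈ dom (k + 1)) : gaugeAct v W ∈ dom (k + 1) := by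
  obtain ⟨hA, hex, hun, hmem⟩ := (hdom (k + 1) W).1 hW
  refine (hdom (k + 1) _).2 ⟨(domAltOfRecord_gaugeAct_mem_iff ν K (k + 1) v W).2 hA, (ukExists_gaugeAct_iff hk εbg v W).2 hex,
    (uniqueUkOrbit_gaugeAct_iff hk εbg v W).2 hun, ?_⟩
  have hrel := Uk_gaugeAct_orbitRel_blockLift hk εbg v hex hun
  exact (mem_bgReg_iff_of_orbitRel hrel).1 (gaugeAct_mem_bgReg _ _ hmem)

include hdom in
/-- The `iff` form (`(W^v)^{v⁻¹} = W`) — the shape FILE 5's per-step token wants for its open set `O`. [cite: Balaban1987RG1, (0.21) p.256 and p.259 (bookkeeping)] -/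
theorem memChar_gaugeAct_iff {k : ℕ} (hk : k + 1 ≤ (F.P K).m + (F.P K).K) (v : GaugeTransf (F.P K) (k + 1) (SU N))
    (W : GaugeField (F.P K) (k + 1) (SU N)) : gaugeAct v W ∈ dom (k + 1) ↔ W ∈ dom (k + 1) := by
  refine ⟨fun h => ?_, memChar_gaugeAct_mem hdom hk v W⟩
  have h' := memChar_gaugeAct_mem hdom hk (invTransf v) _ h
  rwa [gaugeAct_inv_gaugeAct] at h'

include hdom in
/-- **SOLVABILITY AT THE CUT-OFF's RADIUS IS DEFINITIONAL ON A MEMBERSHIP FAMILY** (door v1.2's derived `hsolv`, now without `h11`∕`hreg8`): for `ρ ≤ ν.εreg ≤ εbg`, every member is solvable at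
radius `ν.εreg` — g2 FILE 1's pointwise transfer `ukExists_of_le_of_Uk_mem` at the membership conjunct. [cite: Balaban1985Variational, Thm 1 (6) and (8) p.279; Balaban1987RG1, (1.1)–(1.2) p.260] -/
theorem hsolv_of_memChar (hρreg : ρ ≤ ν.εreg) (hle : ν.εreg ≤ εbg) {k : ℕ} {W : GaugeField (F.P K) k (SU N)} (hW : W ∈ dom k) :
    UkExists F N K k ν.εreg W := by
  obtain ⟨-, hex, -, hmem⟩ := (hdom k W).1 hW
  exact ukExists_of_le_of_Uk_mem hle hex (bgReg_mono hρreg hmem)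

include hdom in
/-- **… AND SO IS ORBIT-UNIQUENESS AT THE CUT-OFF's RADIUS** (door v1.2's derived `huniqDom`): g2 FILE 1's `uniqueUkOrbit_of_le_of_Uk_mem`. [cite: Balaban1985Variational, Thm 1 (6) and (8) p.279; Balaban1987RG1, (1.1)–(1.2) p.260] -/
theorem huniqDom_of_memChar (hρreg : ρ ≤ ν.εreg) (hle : ν.εreg ≤ εbg) {k : ℕ} {W : GaugeField (F.P K) k (SU N)} (hW : W ∈ dom k) :
    UniqueUkOrbit F N K k ν.εreg W := by
  obtain ⟨-, hex, hun, hmem⟩ := (hdom k W).1 hW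
  exact uniqueUkOrbit_of_le_of_Uk_mem hle hex (bgReg_mono hρreg hmem) hun

include hdom in
/-- (1.1) at the search radius is conjuncts 2–3 (the door's former `h11`). [cite: Balaban1987RG1, (1.1) p.260 (bookkeeping)] -/
theorem h11_of_memChar : ∀ k, k ≤ K → ∀ V ∈ dom k, UkExists F N K k εbg V ∧ UniqueUkOrbit F N K k εbg V :=
  fun k _ V hV => ⟨((hdom k V).1 hV).2.1, ((hdom k V).1 hV).2.2.1⟩

end MemChar

/-! ## §1. (M1-dom) on the fibres of a membership family: χ₂₉ lift-invariance from §0 + the on-`dom` axiality -/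

/-- **(M1-dom) ON `S := dom`**: for a membership family with `ρ ≤ θ₀.ν.εreg ≤ εbg` and the record's critical configuration `cd j`-axial over `dom (j+1)` ([I] (2.3)'s convention), the β-slot cut-off
`χ^{(2.9)}_j` is lift-invariant at every (hence a.e.) `U` with `Ū ∈ dom (j+1)` — n09-w2 g2's `chiβ_liftInvariantOn_of_uniqueOrbit_of_axialOn` at the gauge-stable set `dom (j+1)` with `hsolv`,
`huniqDom` DEFINITIONAL (§0).  No covariance∕χ-invariance hypothesis. [cite: Balaban1987RG1, (2.3) p.265 and (2.9) p.266; Balaban1985Variational, Thm 1 p.279 and (181) p.307] -/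
theorem chiβ13_liftInvariant_ae_on_memChar (θ₀ : Stage13Params F N) (P : B12.RunParams) {εbg ρ : ℝ} {dom : (k : ℕ) → Set (GaugeField (F.P P.K) k (SU N))}
    (hdom : ∀ k (V : GaugeField (F.P P.K) k (SU N)), V ∈ dom k ↔
      V ∈ domAltOfRecord F N θ₀.ν P.K k ∧ UkExists F N P.K k εbg V ∧ UniqueUkOrbit F N P.K k εbg V ∧ Uk F N P.K k εbg V ∈ bgReg F N P.K k ρ)
    (cd : (j : ℕ) → ContourData (F.P P.K) j (SU N)) (hρreg : ρ ≤ θ₀.ν.εreg) (hle : θ₀.ν.εreg ≤ εbg)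
    (haxDom : ∀ j < P.K, ∀ W ∈ dom (j + 1), AxialGauge (cd j) (critCfgOfRecord F N θ₀.ν P.K j W)) :
    ∀ j < P.K, ∀ v : GaugeTransf (F.P P.K) (j + 1) (SU N), ∀ᵐ U ∂(fieldMeasure (F.P P.K) j (SU N)),
      (avOfRecord F N P.K j).avg U ∈ dom (j + 1) →
        chiβOfRecord₁₃ F N θ₀ P.K (gOfRecord₁₃ F N θ₀ P) j (gaugeAct (liftTransf v) U) = chiβOfRecord₁₃ F N θ₀ P.K (gOfRecord₁₃ F N θ₀ P) j U :=
  fun j hj v => Filter.Eventually.of_forall fun U hU =>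
    chiβ_liftInvariantOn_of_uniqueOrbit_of_axialOn θ₀ P.K (gOfRecord₁₃ F N θ₀ P) hj (cd j)
      (fun u W hW => memChar_gaugeAct_mem hdom (succ_le_range_of_lt hj) u W hW)
      (fun _ hW => hsolv_of_memChar hdom hρreg hle hW) (fun _ hW => huniqDom_of_memChar hdom hρreg hle hW) (haxDom j hj) v U hU

/-! ## §2. `HCompT` and (1.1)–(1.3) ON THE MEMBERSHIP DOMAIN at the record's own Stage-13 objects (world-free) -/

section Door

variable (θ₀ : Stage13Params F N) (hεχ : 0 < θ₀.ε₂₉) (P : B12.RunParams) {εbg ρ : ℝ} {dom : (k : ℕ) → Set (GaugeField (F.P P.K) k (SU N))}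
  (hdom : ∀ k (V : GaugeField (F.P P.K) k (SU N)), V ∈ dom k ↔
    V ∈ domAltOfRecord F N θ₀.ν P.K k ∧ UkExists F N P.K k εbg V ∧ UniqueUkOrbit F N P.K k εbg V ∧ Uk F N P.K k εbg V ∈ bgReg F N P.K k ρ)
  (cd : (j : ℕ) → ContourData (F.P P.K) j (SU N))
  (hopen : ∀ j < P.K, IsOpen (X := PBond (F.P P.K) (j + 1) → SU N) (dom (j + 1)))
  (haxDom : ∀ j < P.K, ∀ W ∈ dom (j + 1), AxialGauge (cd j) (critCfgOfRecord F N θ₀.ν P.K j W))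
  (haxbg : ∀ k, k ≤ P.K → ∀ V ∈ dom k, ∀ j < k, AxialGauge (cd j) (Averaging.iter (avOfRecord F N P.K) j (Uk F N P.K k εbg V)))
  (hχregU : ∀ i, i + 1 < P.K → ∀ U : GaugeField (F.P P.K) (i + 1) (SU N),
    (avOfRecord F N P.K (i + 1)).avg U ∈ dom (i + 2) →
      U ∉ regSetOfRecord F N P.K i (betaInputOfRecord F N (TβOfRecord₁₃ F N) (chiβOfRecord₁₃ F N θ₀) P.K (gOfRecord₁₃ F N θ₀ P) i) ∩ dom (i + 1) →
        chiβOfRecord₁₃ F N θ₀ P.K (gOfRecord₁₃ F N θ₀ P) (i + 1) U = 0)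
  (hint : ∀ j < P.K, Integrable (betaInputOfRecord F N (TβOfRecord₁₃ F N) (chiβOfRecord₁₃ F N θ₀) P.K (gOfRecord₁₃ F N θ₀ P) j) (fieldMeasure (F.P P.K) j (SU N)))
  (hres : ∀ k, k ≤ P.K → HRestrict F N εbg P.K k (dom k))
  (huniq : ∀ k, k ≤ P.K → ∀ V ∈ dom k, ∀ j < k, UniqueUkOrbit F N P.K (j + 1) εbg (Averaging.iter (avOfRecord F N P.K) (j + 1) (Uk F N P.K k εbg V)))
  (hρ : 0 < ρ) (hρreg : ρ ≤ θ₀.ν.εreg) (hle : θ₀.ν.εreg ≤ εbg)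
  (hρ3 : (143 * (((((F.P P.K).d + 4 : ℕ) : ℝ)) ^ 2 / 4) ^ 2) * ρ ≤ 1 / 3)
  (hρ2 : 2 * ρ ≤ 2 * deltaSU (Fin N) / ((((F.P P.K).d + 4) * (F.P P.K).L : ℕ) : ℝ) ^ 2) (hρ₀ : 2 * ρ ≤ θ₀.ν.ε₀ * ((F.P P.K).L : ℝ) ^ 2)

include hεχ hdom hopen haxDom haxbg hχregU hint hres huniq hρ hρreg hle hρ3 hρ2 hρ₀ in
/-- ★★★ **`HCompT` OF THE RECORD's STAGE-13 TRANSPORT∕CUT-OFFS ON THE MEMBERSHIP DOMAIN**, every level `k ≤ P.K`: dag-n09-w3's on-sets engine `hCompT_of_stepsOn_on` with `S := dom`,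
`D 0 := univ`, `D (i+1) := regSet_i ∩ dom (i+1)`, fed by §1 ((M1-dom) on `dom`), the membership form of (F7a) `hχregU`, the per-step token on the OPEN gauge-stable set `dom (j+1)`
(`stepOn_TβOfRecord₁₃_of_subset_regSet_inter_of_on`), and KERNEL 2's nesting binder.  CONDITIONAL on every displayed hypothesis (module docstring lists the «INHABITED BY» status of each);
nothing of Bałaban asserted. [cite: Balaban1987RG1, (0.21)–(0.23) p.256, (1.1)–(1.3) p.260, p.263, (2.1)–(2.3) p.265, (2.9)–(2.10) pp.266–267, (2.16) p.269; Balaban1985Variational, Thm 1 (6), (8)–(10) p.279 and (181) p.307; Balaban1985Averaging, Prop. 2 (53) p.26] -/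
theorem hCompT_onMembershipFamily :
    ∀ k, k ≤ P.K → HCompT F N (TβOfRecord₁₃ F N) (chiβOfRecord₁₃ F N θ₀) εbg P.K (gOfRecord₁₃ F N θ₀ P) k (dom k) := by
  intro k hk
  refine hCompT_of_stepsOn_on (TβOfRecord₁₃ F N) (chiβOfRecord₁₃ F N θ₀) P.K (gOfRecord₁₃ F N θ₀ P) le_rfl (fun j => dom j)
    (fun j => Nat.rec (motive := fun j => Set (GaugeField (F.P P.K) j (SU N))) Set.univ
      (fun i _ => regSetOfRecord F N P.K i
        (betaInputOfRecord F N (TβOfRecord₁₃ F N) (chiβOfRecord₁₃ F N θ₀) P.K (gOfRecord₁₃ F N θ₀ P) i) ∩ dom (i + 1)) j)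
    (chiβ13_liftInvariant_ae_on_memChar θ₀ P hdom cd hρreg hle haxDom) ?_ ?_ hk (hres k hk) (huniq k hk) ?_
  · intro j hj
    cases j with
    | zero => exact Filter.Eventually.of_forall fun U _ hU => absurd (Set.mem_univ U) hU
    | succ i => exact Filter.Eventually.of_forall (hχregU i hj)
  · intro j hj hlift
    exact stepOn_TβOfRecord₁₃_of_subset_regSet_inter_of_on F N hj _ (hint j hj) (hopen j hj)
      (fun v V => memChar_gaugeAct_iff hdom (succ_le_range_of_lt hj) v V) subset_rfl hlift
  · exact hnestD_of_suppU_of_hierAxial_of_memChar θ₀ hεχ P hdom cd hχregU hres huniq hρ hρreg hle haxbg haxDom hρ3 hρ2 hρ₀ k hk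

include hεχ hdom hopen haxDom haxbg hχregU hint hres huniq hρ hρreg hle hρ3 hρ2 hρ₀ in
/-- ★★★ **(1.1)–(1.3) ON THE MEMBERSHIP DOMAIN AT THE RECORD's OWN STAGE-13 OBJECTS — WORLD-FREE**: for every run `P` and level `k ≤ P.K` at which the flow recursion (0.20) of the record's
β-functions holds up to `k`, the inductive description `IndAOfRecordT (TβOfRecord₁₃) (χ₂₉ of record) εbg (β of record) P k … (dom k)` — (1.1) existence∕uniqueness ON `dom k` (definitional) ∧
(0.22)∕(0.23)∕(1.3) for the record's `A_k`, `A^η(U_k)`, `𝐄_k` — holds (node00-def-B's `indAOfRecordT_atRecord` fed by `hCompT_onMembershipFamily`).  This is a theorem ABOUT THE RECORD on the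
SMALLER domain; no core, datum or world is mentioned.  CONDITIONAL on the displayed rows; nothing of Bałaban asserted; N09 NOT discharged (the record's leaves are stated on `domAltOfRecord`).
[cite: Balaban1987RG1, (1.1)–(1.3) p.260, (0.20)–(0.23) p.256, Thm 3 p.264 and p.265; Balaban1985Variational, Thm 1 (6), (8)–(10) p.279] -/
theorem indA_onMembershipFamily :
    ∀ k, k ≤ P.K → RGEqH k (betaOfRecord₁₃ F N θ₀) (genSeq (betaOfRecord₁₃ F N θ₀) P.g0) →
      IndAOfRecordT F N (TβOfRecord₁₃ F N) (chiβOfRecord₁₃ F N θ₀) εbg (betaOfRecord₁₃ F N θ₀) P k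
        (prefixOf (genSeq (betaOfRecord₁₃ F N θ₀) P.g0) k) (dom k)
        (effActionOfRecordT F N (TβOfRecord₁₃ F N) (chiβOfRecord₁₃ F N θ₀) (betaOfRecord₁₃ F N θ₀) P k) (wilsonBGOfRecord F N εbg P k)
        (EkOfRecordT F N (TβOfRecord₁₃ F N) (chiβOfRecord₁₃ F N θ₀) εbg (betaOfRecord₁₃ F N θ₀) P k) :=
  fun k hk hrg => indAOfRecordT_atRecord F N (TβOfRecord₁₃ F N) (chiβOfRecord₁₃ F N θ₀) εbg (betaOfRecord₁₃ F N θ₀) P k (dom k) (fun _ _ => rfl) hrg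
    (h11_of_memChar hdom k hk) (hCompT_onMembershipFamily θ₀ hεχ P hdom cd hopen haxDom haxbg hχregU hint hres huniq hρ hρreg hle hρ3 hρ2 hρ₀ k hk)

/-! ## §3. The world-generic member (the day a core with `dom := domU^ρ` lands, `hind` is `Iff.rfl`) -/

include hεχ hdom hopen haxDom haxbg hχregU hint hres huniq hρ hρreg hle hρ3 hρ2 hρ₀ in
/-- ★★ **N09's THEOREM-3 MEMBER FOR A WORLD WHOSE RUN-`P` CONSTRUCTION HAS FLOW `genFlow (β of record) P.g₀` AND `IndAss k` = (1.1)–(1.3) ON `dom k`** (`hflow`, `hind` DISPLAYED — the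
shape of `B12HInvUnconditional` §3's plug; no landed core has `dom := domU^ρ` today, director-ym №313 (R4) «(D1′) deferred»): `smallCouplings → smallFieldInductive` from §2.  CONDITIONAL;
nothing of Bałaban asserted; N09 NOT discharged; K1⁹ NOT closed. [cite: Balaban1987RG1, Thm 3 p.264, (1.1)–(1.3) p.260, (2.1)–(2.3) p.265 and (2.16) p.269; Balaban1985Variational, Thm 1 (8)–(10) p.279] -/
theorem thm3Member_onMembershipFamily_of_hind {w : WorldP} (hflow : (w.C P).flow = genFlow (betaOfRecord₁₃ F N θ₀) P.g0)
    (hind : ∀ k, k ≤ P.K → ((w.C P).IndAss k ↔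
      IndAOfRecordT F N (TβOfRecord₁₃ F N) (chiβOfRecord₁₃ F N θ₀) εbg (betaOfRecord₁₃ F N θ₀) P k
        (prefixOf (genSeq (betaOfRecord₁₃ F N θ₀) P.g0) k) (dom k)
        (effActionOfRecordT F N (TβOfRecord₁₃ F N) (chiβOfRecord₁₃ F N θ₀) (betaOfRecord₁₃ F N θ₀) P k) (wilsonBGOfRecord F N εbg P k)
        (EkOfRecordT F N (TβOfRecord₁₃ F N) (chiβOfRecord₁₃ F N θ₀) εbg (betaOfRecord₁₃ F N θ₀) P k))) :
    (leavesP w P).smallCouplings → (leavesP w P).smallFieldInductive :=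
  B12NodeKnitIndAPlug.thm3Member_of_flow_of_steps (betaOfRecord₁₃ F N θ₀) hflow fun k hk hrg =>
    (hind k hk).2 (indA_onMembershipFamily θ₀ hεχ P hdom cd hopen haxDom haxbg hχregU hint hres huniq hρ hρreg hle hρ3 hρ2 hρ₀ k hk hrg)

end Door

end Summit.QuantumFields.YangMills.BalabanUVNodes.N09MembershipDomainDoor

end
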